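import Literature.MathematicalPhysics.QuantumFieldTheory.Balaban1983to89.B14Sect3
import Literature.MathematicalPhysics.QuantumFieldTheory.Balaban1983to89.Node00.Record13CoPH

/-!
# DAG node N11 — [III] THEOREM 2's 𝐄-SIDE (2.43)_j AT THE ₁₃ OBJECTS FROM ITS PRINTED PROOF SENTENCE (3.67) p. 283 («𝐄^{(j)}(Λ_j,U_k,z) − 𝐄^{(j)}(Λ_j,1,z) − β_jA(h_z,U_k) =
# O((LʲL⁻ⁿ)^{5−β}) for z ∈ Λ_j⁰∩(Ω_n∖Ω_{n+1}) … Summing over z ∈ Λ_j⁰∩Ω we get (2.43) (with 1 − β, β > 0, instead of β < 1)») and the resummation (3.65) `φ_j = Σ_z h_z`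

Cell `pub-ymgap`, YM-PLAN Track A (HUMAN RULING D-0062 ∕ D-0149), seat `pub-ymgap-dag-n11-w2` (g0), route `BalabanUVNodes`, key item K1⁷ `StabilityBAtRecordR13SepCoPH` =
stmt-QuantumFields-20542 (helper, count-neutral).  Companion of this seat's `BalabanUVNodesN11Thm2Ineq249AtRecord13CoPH` (file 1), whose binder `h243` is (2.43)_j at
Ω = Bʲ(Λ_j⁰), φ = φ_j read on the (2.25) summand `EjSub − β_j(g_{j−1})·A(φ_j, U)` of the record, and of `…Thm2RSideAtRecord13CoPH` (the 𝐑-side twin).  [III] = [Balaban1988Convergent].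

WHY THIS FILE.  [III] p. 283 closes the proof of (2.43) in two sentences: the per-point estimate (3.67) for `z ∈ Λ_j⁰ ∩ (Ω_n∖Ω_{n+1})` and «Summing over z ∈ Λ_j⁰∩Ω we get the
inequality (2.43)»; the counterterm enters per point through the partition (3.65) `A(φ_j, U_k) = Σ_z A(h_z, U_k)` of the cut-off `φ_j`.  The cell's Literature types the summation
over the ABSTRACT carrier (`B14Sect3.Rep367 ∕ ineq243_of_rep367 ∕ pointSum_le`, `B14.Eq367Assembly`).  THIS FILE performs it AT THE (2.25)-SUMMAND OF RECORD: r11's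
`EjSub T admE j U = Σ_X Σ_z admE·[𝐄^{(j)}(X,U,z) − 𝐄^{(j)}(X,1,z)]` regrouped by the point `z`, the smeared Wilson action split along `φ_j = Σ_{z∈Z} h_z` (linearity of
`smearedWilson` in the weight), the per-point sentence (3.67) and the p. 263 point count «at most (L^{n−j})⁴|Γ_n∩Ω| points of scale n» as DISPLAYED hypotheses ⇒ file 1's binder
`h243` at scale `j` with `E₁ = c` and exponent `1 − b` — print's own «(with 1 − β, β > 0, instead of β < 1)».

WHAT THIS FILE PROVES (0 `sorry`, 0 `def`, standard axioms; count-neutral; nothing of Bałaban's asserted — (3.67), (3.65) and the count are HYPOTHESES, displayed).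
§1 generic over any `Step.LFTower` with r11's (2.26)–(2.27) range predicate: `smearedWilson_finset_sum` (`A(Σ_{z∈Z} h_z, U) = Σ_{z∈Z} A(h_z, U)`) · `EjSub_eq_sum_points` (`EjSub`
regrouped by points, restricted to the support `Z`) · `eSummand_eq_sum_perPoint` ((2.25) summand − counterterm = Σ_{z∈Z} [per-point bracket of (3.67)]) · ★ `eSummand_abs_le_of_perPoint`
((3.67) per point + scales `n_z ∈ [j,k]` + p. 263 count ⇒ `|EjSub − β_jA(φ_j,U)| ≤ c·Σ_{n=j}^{k}(L^{j−n})^{1−b}Γ_n`).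
§2 at the ₁₃ objects: ★★ `h243_at_record₁₃CoPH_of_perPoint` — file 1's binder `h243` at scale `j` for the witness `t.E` over `𝐃_j` of record at `settingOfRecord₁₃`∕`θ.rzAt p s`
(`φ_j = θ.Phih p k s.Ω s.Λ j`, `β_j(g_{j−1}) = g_{j−1}^{−2} − g_j^{−2}`, points `Site (F.P p.K) j`), from (3.67) per point, (3.65) and the count.

HONEST FRAMING.  Count-neutral kernel bookkeeping; (3.67) IS [III] §3's analysis pp. 279–283 (nobody's theorem in the tree; n11-b's `B14Eq366Irrelevant` ∕ `B14Eq367Assembly`-side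
files type display-level pieces), (3.65) is the choice of the partition `h_z` (print p. 283), the count is the p. 263 sentence.  N11 NOT discharged; K1⁷ NOT closed; counts unmoved
(typed 28∕28 · discharged 5∕27).  One finite four-torus programme at fixed `ε = L^{−K}`; R4 closes only the conditional finite-𝕋⁴ rung `BalabanLadder.UV`; NOT ℝ⁴, NOT OS, NOT a mass
gap, NOT Clay.  Sources: [III] (2.43) p. 263, (3.65)–(3.67) p. 283, (2.25)–(2.27) p. 259.
-/

noncomputable section

open scoped BigOperators Matrix.Norms.L2Operator

namespace Summit.QuantumFields.YangMills.Theorems.BalabanUVNodesN11Thm2ESideAtRecord13CoPH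

open Literature.MathematicalPhysics.QuantumFieldTheory.Balaban1983to89 Step B14.Eq225Concrete Finset
open T4Continuum Node00

/-! ## §1. Generic: (2.25)'s summand regrouped by points, the counterterm split along `φ_j = Σ_z h_z`, (3.67) per point + the p. 263 count ⇒ (2.43)_j's shape -/

section Generic

variable {P : Params} {G : Type*} [GaugeGroup G] {Φ 𝒢 𝔄 : Type*}

/-- Linearity of the smeared Wilson action in the weight over a finite family: `A(Σ_{z∈Z} h_z, U) = Σ_{z∈Z} A(h_z, U)` ((3.65)–(3.66): `A(φ_j,U) = Σ_z A(h_z,U)`).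
[cite: Balaban1988Convergent, (3.65)–(3.66) p.283] -/
theorem smearedWilson_finset_sum {ι : Type*} (Z : Finset ι) (h : ι → Plaq P 0 → ℝ) (U : GaugeField P 0 G) :
    smearedWilson (fun q => ∑ z ∈ Z, h z q) U = ∑ z ∈ Z, smearedWilson (h z) U := by
  unfold smearedWilson
  rw [Finset.sum_comm]
  refine Finset.sum_congr rfl fun q _ => ?_
  rw [Finset.sum_mul]

variable (T : LFTower P G Φ 𝒢 𝔄) (admE : (j : ℕ) → (T.sys j).Dom → T.Pt j → Bool)

/-- **`EjSub` regrouped by points** on a support `Z ⊇ {z : some admE j X z}`: `EjSub T admE j U = Σ_{z∈Z} Σ_X admE·[𝐄^{(j)}(X,U,z) − 𝐄^{(j)}(X,1,z)]` ((2.26): `𝐄^{(j)}(Λ_j,U,z) = Σ_{X∋z} …`).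
[cite: Balaban1988Convergent, (2.25)–(2.27) p.259] -/
theorem EjSub_eq_sum_points (j : ℕ) (U : GaugeField P 0 G) (Z : Finset (T.Pt j)) (hZ : ∀ z, z ∉ Z → ∀ X, admE j X z = false) :
    EjSub T admE j U = ∑ z ∈ Z, ∑ X : (T.sys j).Dom,
      (if admE j X z then ((T.E j X z (T.flow.g (j - 1)) (T.ofBackground U)).re - (T.E j X z (T.flow.g (j - 1)) (T.ofBackground 1)).re) else 0) := by
  classical
  unfold EjSub
  rw [Finset.sum_comm]
  symm
  refine Finset.sum_subset (Finset.subset_univ Z) fun z _ hz => ?_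
  refine Finset.sum_eq_zero fun X _ => ?_
  rw [hZ z hz X]
  simp

/-- **The (2.25) summand minus its counterterm IS the sum of the per-point brackets of (3.67)** along a partition `φ_j = Σ_{z∈Z} h_z` supported on `Z`:
`EjSub − β_j(g_{j−1})·A(φ_j,U) = Σ_{z∈Z} ( Σ_X admE·Δ𝐄^{(j)}(X,·,z) − β_j(g_{j−1})·A(h_z,U) )`. [cite: Balaban1988Convergent, (3.65)–(3.67) p.283, (2.25) p.259] -/
theorem eSummand_eq_sum_perPoint (φ : ℕ → Plaq P 0 → ℝ) (j : ℕ) (U : GaugeField P 0 G) (Z : Finset (T.Pt j)) (h : T.Pt j → Plaq P 0 → ℝ)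
    (hφ : ∀ q, φ j q = ∑ z ∈ Z, h z q) (hZ : ∀ z, z ∉ Z → ∀ X, admE j X z = false) :
    EjSub T admE j U - T.flow.β j (T.flow.g (j - 1)) * smearedWilson (φ j) U =
      ∑ z ∈ Z, (∑ X : (T.sys j).Dom,
        (if admE j X z then ((T.E j X z (T.flow.g (j - 1)) (T.ofBackground U)).re - (T.E j X z (T.flow.g (j - 1)) (T.ofBackground 1)).re) else 0)
        - T.flow.β j (T.flow.g (j - 1)) * smearedWilson (h z) U) := by
  have hφ' : φ j = fun q => ∑ z ∈ Z, h z q := funext hφ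
  rw [EjSub_eq_sum_points T admE j U Z hZ, hφ', smearedWilson_finset_sum, Finset.mul_sum, ← Finset.sum_sub_distrib]

/-- **★ (2.43)_j's SHAPE FROM (3.67) PER POINT**: points `z ∈ Z` (the support of the (2.26)–(2.27) range and of the partition `h`) carry scales `n_z ∈ [j, k]` (`z ∈ Ω_n∖Ω_{n+1}`), the
per-point bracket obeys (3.67) `|Σ_X admE·Δ𝐄^{(j)}(X,·,z) − β_j·A(h_z,U)| ≤ c·(L^{j−n_z})^{5−b}`, and at most `(L^{n−j})⁴·Γ_n` points have scale `n` (p. 263).  THEN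
`|EjSub − β_j(g_{j−1})·A(φ_j,U)| ≤ c·Σ_{n=j}^{k} (L^{j−n})^{1−b}·Γ_n` — (2.43) at Ω = Bʲ(Λ_j⁰), φ = φ_j with `E₁ = c` «(with 1 − β, β > 0, instead of β < 1)».  Kernel: `eSummand_eq_sum_perPoint` +
`B14Sect3.pointSum_le`. [cite: Balaban1988Convergent, (2.43) p.263, (3.67) p.283] -/
theorem eSummand_abs_le_of_perPoint (φ : ℕ → Plaq P 0 → ℝ) (j k : ℕ) (U : GaugeField P 0 G) (Z : Finset (T.Pt j)) (h : T.Pt j → Plaq P 0 → ℝ)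
    (hφ : ∀ q, φ j q = ∑ z ∈ Z, h z q) (hZ : ∀ z, z ∉ Z → ∀ X, admE j X z = false) (sc : T.Pt j → ℕ) (hsc : ∀ z ∈ Z, j ≤ sc z ∧ sc z ≤ k)
    {c L b : ℝ} (hL : 0 < L) (hc : 0 ≤ c)
    (h367 : ∀ z ∈ Z, |(∑ X : (T.sys j).Dom,
        (if admE j X z then ((T.E j X z (T.flow.g (j - 1)) (T.ofBackground U)).re - (T.E j X z (T.flow.g (j - 1)) (T.ofBackground 1)).re) else 0))
        - T.flow.β j (T.flow.g (j - 1)) * smearedWilson (h z) U| ≤ c * (L ^ ((j : ℝ) - sc z)) ^ (5 - b))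
    (Γ : ℕ → ℝ) (hcount : ∀ n, ((Z.filter (fun z => sc z = n)).card : ℝ) ≤ (L ^ ((n : ℝ) - j)) ^ (4 : ℝ) * Γ n) :
    |EjSub T admE j U - T.flow.β j (T.flow.g (j - 1)) * smearedWilson (φ j) U| ≤ c * ∑ n ∈ Icc j k, (L ^ ((j : ℝ) - n)) ^ (1 - b) * Γ n := by
  rw [eSummand_eq_sum_perPoint T admE φ j U Z h hφ hZ]
  have hmain := B14Sect3.pointSum_le Z sc (fun z => (∑ X : (T.sys j).Dom,
      (if admE j X z then ((T.E j X z (T.flow.g (j - 1)) (T.ofBackground U)).re - (T.E j X z (T.flow.g (j - 1)) (T.ofBackground 1)).re) else 0))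
      - T.flow.β j (T.flow.g (j - 1)) * smearedWilson (h z) U) j k L c (5 - b) Γ hL hc hsc h367 hcount
  have e : (5 : ℝ) - b - 4 = 1 - b := by ring
  rw [e] at hmain
  exact hmain

end Generic

/-! ## §2. At the ₁₃ objects: file 1's binder `h243` at scale `j` from (3.67) per point on the witness's 𝐄-terms over `𝐃_j` of record -/

section AtRecord13

variable {F : T4Family} {N : ℕ} [NeZero N]
variable (θ : Stage13HParams F N) (p : B12.RunParams) {k : ℕ}

/-- **★★ (2.43)_j AT NODE 00's STAGE-13 OBJECTS FROM (3.67) PER POINT** (p. 283): for the history `s`, the witness `t` (its 𝐄-terms `t.E j X z` over `𝐃_j` of record, points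
`z ∈ T₁^{(j)} = Site (F.P p.K) j`), the (2.26)–(2.27) range `Sect2.admE … s.Λ j`, the history's cut-off `φ_j = θ.Phih p k s.Ω s.Λ j` split as `Σ_{z∈Z} h_z` ((3.65), `hφ`; `Z` ⊇ the
range's points, `hZ`), scales `n_z ∈ [j,k]`, the per-point sentence (3.67) with constant `c` and exponent `5 − b` (`h367`) and the p. 263 count (`hcount`): file 1's binder `h243`
holds at scale `j` with `E₁ = c`, `β = 1 − b`: `|EjSub(…of record…) j U − (g_{j−1}^{−2} − g_j^{−2})·A(φ_j,U)| ≤ c·Σ_{n=j}^{k}(L^{j−n})^{1−b}·Γ_n`.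
[cite: Balaban1988Convergent, (2.43) p.263, (3.65)–(3.67) p.283, (2.25)–(2.27) p.259] -/
theorem h243_at_record₁₃CoPH_of_perPoint (s : SeqOfRecord F θ.ν θ.τ9.M (gOfRecord₁₃ F N θ.toStage13Params p) p.K k)
    (t : Sect2.TermValues (F.P p.K) (MatA N) (FluctV N) θ.τ9.M) (U : GaugeField (F.P p.K) 0 (SU N)) (j : ℕ)
    (Z : Finset (Site (F.P p.K) j)) (h : Site (F.P p.K) j → Plaq (F.P p.K) 0 → ℝ)
    (hφ : ∀ q, θ.Phih p k s.Ω s.Λ j q = ∑ z ∈ Z, h z q)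
    (hZ : ∀ z, z ∉ Z → ∀ X, Sect2.admE (F.P p.K) θ.ν θ.τ9.M (gOfRecord₁₃ F N θ.toStage13Params p) s.Λ j (Sect2.domSites (F.P p.K) θ.τ9.M j X) z = false)
    (sc : Site (F.P p.K) j → ℕ) (hsc : ∀ z ∈ Z, j ≤ sc z ∧ sc z ≤ k) {c L b : ℝ} (hL : 0 < L) (hc : 0 ≤ c)
    (h367 : ∀ z ∈ Z, |(∑ X : (Sect2.domSys (F.P p.K) θ.τ9.M j).Dom,
        (if Sect2.admE (F.P p.K) θ.ν θ.τ9.M (gOfRecord₁₃ F N θ.toStage13Params p) s.Λ j (Sect2.domSites (F.P p.K) θ.τ9.M j X) z then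
          ((t.E j X z (gOfRecord₁₃ F N θ.toStage13Params p (j - 1)) (Sect2.ofBackgroundC (ιSU N) U)).re -
            (t.E j X z (gOfRecord₁₃ F N θ.toStage13Params p (j - 1)) (Sect2.ofBackgroundC (ιSU N) 1)).re) else 0))
        - (1 / gOfRecord₁₃ F N θ.toStage13Params p (j - 1) ^ 2 - 1 / gOfRecord₁₃ F N θ.toStage13Params p j ^ 2) * smearedWilson (h z) U| ≤
        c * (L ^ ((j : ℝ) - sc z)) ^ (5 - b))
    (Γ : ℕ → ℝ) (hcount : ∀ n, ((Z.filter (fun z => sc z = n)).card : ℝ) ≤ (L ^ ((n : ℝ) - j)) ^ (4 : ℝ) * Γ n) :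
    |EjSub (sect2TowerOfRecord F N (FluctV N) p.K (settingOfRecord₁₃ F N θ.toStage13Params p) (θ.rzAt p s) s t)
          (fun j X z => Sect2.admE (F.P p.K) θ.ν θ.τ9.M (gOfRecord₁₃ F N θ.toStage13Params p) s.Λ j (Sect2.domSites (F.P p.K) θ.τ9.M j X) z) j U
        - (1 / gOfRecord₁₃ F N θ.toStage13Params p (j - 1) ^ 2 - 1 / gOfRecord₁₃ F N θ.toStage13Params p j ^ 2) *
            smearedWilson (θ.Phih p k s.Ω s.Λ j) U| ≤ c * ∑ n ∈ Icc j k, (L ^ ((j : ℝ) - n)) ^ (1 - b) * Γ n :=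
  eSummand_abs_le_of_perPoint (sect2TowerOfRecord F N (FluctV N) p.K (settingOfRecord₁₃ F N θ.toStage13Params p) (θ.rzAt p s) s t)
    (fun j X z => Sect2.admE (F.P p.K) θ.ν θ.τ9.M (gOfRecord₁₃ F N θ.toStage13Params p) s.Λ j (Sect2.domSites (F.P p.K) θ.τ9.M j X) z)
    (θ.Phih p k s.Ω s.Λ) j k U Z h hφ hZ sc hsc hL hc h367 Γ hcount

end AtRecord13

end Summit.QuantumFields.YangMills.Theorems.BalabanUVNodesN11Thm2ESideAtRecord13CoPH

end
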